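import Summits.CriticalPhenomena.PercolationContinuityZ3.Theorems.PercNearOneGluingNoHeavyQuantFarCycleBlockStems
import Summits.CriticalPhenomena.PercolationContinuityZ3.Theorems.PercNearOneGluingNoHeavyQuantFarDecLawCycDec
import Summits.CriticalPhenomena.PercolationContinuityZ3.Theorems.PercNearOneGluingNoHeavyQuantFarBlockTransfer
import HarnessLib

/-!
# QUANT lane R8, front "FAR beyond trees", layer one — PENDANT CYCLE BLOCKS VI: **THE k-HUB TRANSFER THEOREM**
# (a pendant cycle carrying ANY NUMBER of loaded vertices with ARBITRARY pendant structures may be replaced by independent stems at its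
# cut vertex for the purpose of FAR at layer one)

builds on p205010 (kernel theorem, internal audit signed; external expert review pending)

Support file (`--supports stmt-CriticalPhenomena-4575`), seat `prim-quant-p1` (gen 22); memo
`run/shared/lean/prim/quant/prim-quant-p1-g22/FOR-LEAD-KHUB.md` §5.  Standard axioms; no sorries; no definitions.

ASSEMBLY of the k-hub graph transfer asked for in p1 g21's memo `FOR-LEAD-CYCDEC.md` §6(5):
* the internal numbers of the block are `(hh, tt)` of the two-chain of the loaded positions (`Block.real_blockCount_ge_one/two`:
  `…QuantFarCycleBlockReach` + `…Law`), those of the hub-decoupled block are `(hProd, tProd)` (`Block.real_blockCount_cd_ge_one/two`: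
  `…QuantFarCycleBlockDecouple`);
* the least internal tip marginal `q` satisfies `q ≤ m_i u_i` for every loaded hub (`Block.tip_le_mu`);
* the law-level theorem `TwoChain.cycDec` (p1 g21, `…QuantFarDecLawCycDec`) gives the domination, and the block-transfer theorem
  `Block.real_card_le_one_le_of_dominates` (p1 g19, `…QuantFarBlockTransfer`) concludes:
**`Block.real_card_le_one_le_cycleBlock`** — for a pendant cycle block with hubs and its hub-decoupled weights `w'`: `P_{w'}(N ≤ 1) ≤ t` and
`P_w(o ↮ a) ≤ t` on the block relays imply `P_w(N ≤ 1) ≤ t`;  `Block.real_openConn_cdecouple_eq` — marginals are preserved;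
**`Block.farLayerOne_cycleBlock`** — the `j = 1` FAR instance transfers from the decoupled weights.  With p1 g19's cactus assembly this is FAR
at layer one on EVERY cactus (`…QuantFarLayerOneCactusAll`).  [cite: KozmaNitzan2024, Conjecture 3 (p. 15)] (the row); [this work].
-/

noncomputable section

namespace Summit.CriticalPhenomena.PercolationContinuityZ3.Theorems

namespace Quant

namespace Block

open Finset MeasureTheory Set
open Literature.Probability.LatticeModels
open Literature.Probability.Percolation
open Summit.CriticalPhenomena.PercolationContinuityZ3.Theorems.HairyCycle (cycE CW CCW RC)
open Bundle (offZ avoid real_offZ_event_eq_of_agree)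
open TwoChain (hProd tProd hh tt omH TT)
open scoped Classical

variable {n : ℕ}

section CycleBlock

variable {L : ℕ} {cyc : ℕ → Fin n} {S : ℕ → Finset (Fin n)} {Z : Finset (Fin n)} (H : IsCycleBlock L cyc S Z)
  (w : Sym2 (Fin n) → unitInterval) (hw : CycleHang L cyc S Z w) (A : Finset (Fin n))
include H hw

/-! ## The four block numbers -/

/-- `P_w(X ≥ 1) = hh N C` for the two-chain `C` of the loaded positions. [this work] -/
theorem real_blockCount_ge_one :
    (prodBernoulli w).real {ω | 1 ≤ ((A ∩ Z).filter fun a => onZ Z ω ∈ openConn (cyc 0) a).card} =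
      hh (loadedList L cyc S A).length (chainOf L cyc S A w 0 (loadedList L cyc S A)) := by
  have hmeas : ∀ U : Set (BondConfig (Fin n)), MeasurableSet U := fun U => (Set.toFinite U).measurableSet
  rw [real_card_on_eq_arcCount H hw A (fun k => 1 ≤ k)]
  have e : {ω : BondConfig (Fin n) | 1 ≤ arcCount L cyc S A ω} = {ω | arcCountL L cyc S A (loadedList L cyc S A) ω = 0}ᶜ := by
    ext ω; simp only [mem_setOf_eq, Set.mem_compl_iff, arcCount_eq_arcCountL]; omega
  rw [e, probReal_compl_eq_one_sub (hmeas _), real_arcCountL_eq_zero H A w (loadedList_bound L cyc S A) (loadedList_sorted L cyc S A)]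
  rfl

/-- `P_w(X ≥ 2) = tt N C`. [this work] -/
theorem real_blockCount_ge_two :
    (prodBernoulli w).real {ω | 2 ≤ ((A ∩ Z).filter fun a => onZ Z ω ∈ openConn (cyc 0) a).card} =
      tt (loadedList L cyc S A).length (chainOf L cyc S A w 0 (loadedList L cyc S A)) := by
  rw [real_card_on_eq_arcCount H hw A (fun k => 2 ≤ k)]
  have e : {ω : BondConfig (Fin n) | 2 ≤ arcCount L cyc S A ω} = {ω | 2 ≤ arcCountL L cyc S A (loadedList L cyc S A) ω} := by
    ext ω; simp only [mem_setOf_eq, arcCount_eq_arcCountL]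
  rw [e, real_arcCountL_ge_two H A w (loadedList_bound L cyc S A) (loadedList_sorted L cyc S A)]
  rfl

/-- `P_{w'}(X ≥ 1) = hProd N C` for the hub-decoupled weights. [this work] -/
theorem real_blockCount_cd_ge_one :
    (prodBernoulli (cdecouple L cyc S Z w)).real {ω | 1 ≤ ((A ∩ Z).filter fun a => onZ Z ω ∈ openConn (cyc 0) a).card} =
      hProd (loadedList L cyc S A).length (chainOf L cyc S A w 0 (loadedList L cyc S A)) := by
  rw [real_card_on_eq_stemCount H w A (fun k => 1 ≤ k)]
  have e : {ω : BondConfig (Fin n) | 1 ≤ stemCount L cyc S A ω} = {ω | 1 ≤ stemCountL cyc S A (loadedList L cyc S A) ω} := by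
    ext ω; simp only [mem_setOf_eq, stemCount_eq_stemCountL]
  rw [e]
  exact (real_stemCountL H w hw A _ 0 (loadedList_bound L cyc S A) ((loadedList_sorted L cyc S A).imp ne_of_lt)).1

/-- `P_{w'}(X ≥ 2) = tProd N C`. [this work] -/
theorem real_blockCount_cd_ge_two :
    (prodBernoulli (cdecouple L cyc S Z w)).real {ω | 2 ≤ ((A ∩ Z).filter fun a => onZ Z ω ∈ openConn (cyc 0) a).card} =
      tProd (loadedList L cyc S A).length (chainOf L cyc S A w 0 (loadedList L cyc S A)) := by
  rw [real_card_on_eq_stemCount H w A (fun k => 2 ≤ k)]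
  have e : {ω : BondConfig (Fin n) | 2 ≤ stemCount L cyc S A ω} = {ω | 2 ≤ stemCountL cyc S A (loadedList L cyc S A) ω} := by
    ext ω; simp only [mem_setOf_eq, stemCount_eq_stemCountL]
  rw [e]
  exact (real_stemCountL H w hw A _ 0 (loadedList_bound L cyc S A) ((loadedList_sorted L cyc S A).imp ne_of_lt)).2

/-! ## The exit point -/

omit hw in
/-- The arc event to `p` and an event read off hub `p` are independent. [this work] -/
theorem real_RC_inter_hub {p : ℕ} (hp : 1 ≤ p ∧ p < L) (P : ℕ → Prop) :
    (prodBernoulli w).real ({ω | RC L cyc ω p} ∩ {ω | P (hubCount cyc S A p ω)}) =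
      (prodBernoulli w).real {ω | RC L cyc ω p} * (prodBernoulli w).real {ω | P (hubCount cyc S A p ω)} := by
  have hmeas : ∀ U : Set (BondConfig (Fin n)), MeasurableSet U := fun U => (Set.toFinite U).measurableSet
  have dRC : DeterminedBy {ω : BondConfig (Fin n) | RC L cyc ω p} (↑(cwEdges L cyc p ∪ ccwEdges L cyc p) : Set (Sym2 (Fin n))) := by
    have h := ((readsOff_CW L cyc p).map₂ (readsOff_CCW L cyc p) (· ∨ ·)).determinedBy id
    rw [Finset.coe_union]; exact h
  have hd : Disjoint (cwEdges L cyc p ∪ ccwEdges L cyc p) (hubPairs (S p) (cyc p)) := by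
    rw [Finset.disjoint_union_left]
    exact ⟨disjoint_cwEdges_hubPairs H hp.2.le hp.1 hp.2, disjoint_ccwEdges_hubPairs H p hp.1 hp.2⟩
  exact prodBernoulli_real_inter_of_determinedBy_disjoint w hd dRC ((readsOff_hubCount cyc S A p).determinedBy P) (hmeas _) (hmeas _)

omit hw in
/-- An event read off the inner pairs of hub `p` is independent of the arc event to `p`. [this work] -/
theorem real_RC_inter_inS {p : ℕ} (hp : 1 ≤ p ∧ p < L) (P : BondConfig (Fin n) → Prop) :
    (prodBernoulli w).real ({ω | RC L cyc ω p} ∩ {ω | P (inS (S p) (cyc p) ω)}) =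
      (prodBernoulli w).real {ω | RC L cyc ω p} * (prodBernoulli w).real {ω | P (inS (S p) (cyc p) ω)} := by
  have hmeas : ∀ U : Set (BondConfig (Fin n)), MeasurableSet U := fun U => (Set.toFinite U).measurableSet
  have dRC : DeterminedBy {ω : BondConfig (Fin n) | RC L cyc ω p} (↑(cwEdges L cyc p ∪ ccwEdges L cyc p) : Set (Sym2 (Fin n))) := by
    have h := ((readsOff_CW L cyc p).map₂ (readsOff_CCW L cyc p) (· ∨ ·)).determinedBy id
    rw [Finset.coe_union]; exact h
  have hd : Disjoint (cwEdges L cyc p ∪ ccwEdges L cyc p) (hubPairs (S p) (cyc p)) := by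
    rw [Finset.disjoint_union_left]
    exact ⟨disjoint_cwEdges_hubPairs H hp.2.le hp.1 hp.2, disjoint_ccwEdges_hubPairs H p hp.1 hp.2⟩
  exact prodBernoulli_real_inter_of_determinedBy_disjoint w hd dRC (determinedBy_inS (S p) (cyc p) P) (hmeas _) (hmeas _)

/-- **The least internal tip marginal is an admissible exit value**: if `q ≤ P_w(c ↔ a on Z)` for every block relay `a`, then
`q ≤ m_i·u_i` for every loaded hub `i` of the two-chain. [this work] -/
theorem tip_le_mu (q : ℝ) (hq : ∀ a ∈ A ∩ Z, q ≤ (prodBernoulli w).real {ω | onZ Z ω ∈ openConn (cyc 0) a}) :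
    ∀ i, i < (loadedList L cyc S A).length →
      q ≤ (chainOf L cyc S A w 0 (loadedList L cyc S A)).m (i + 1) * (chainOf L cyc S A w 0 (loadedList L cyc S A)).u (i + 1) := by
  intro i hi
  set ps := loadedList L cyc S A with hpsdef
  set p := ps[i] with hpdef
  have hpmem : p ∈ ps := List.getElem_mem hi
  have hp : 1 ≤ p ∧ p < L := loadedList_bound L cyc S A p hpmem
  have hload : Loaded cyc S A p := ((mem_loadedList L cyc S A).1 hpmem).2.2
  have hpos : lpos L 0 ps (i + 1) = p := lpos_of_lt_length hi
  have hm : (chainOf L cyc S A w 0 ps).m (i + 1) = (prodBernoulli w).real {ω | RC L cyc ω p} := by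
    simp only [TwoChain.m, chainOf, hpos]; rw [real_RC w H hp.2.le]
  have hu : (chainOf L cyc S A w 0 ps).u (i + 1) = (prodBernoulli w).real {ω | 1 ≤ hubCount cyc S A p ω} := by
    simp only [TwoChain.u, chainOf, hpos]; rw [real_hubCount_ge_one]
  rw [hm, hu]
  rcases hload with ⟨a, ha⟩ | hcp
  · -- a relay inside the hub
    have haZ : a ∈ A ∩ Z := Finset.mem_inter.2 ⟨(Finset.mem_inter.1 ha).1, H.SZ p hp.1 hp.2 (Finset.mem_inter.1 ha).2⟩
    refine (hq a haZ).trans ?_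
    rw [real_onReach_hub_eq H hw hp.1 hp.2 (Finset.mem_inter.1 ha).2, ← real_RC_inter_hub H w A hp (fun k => 1 ≤ k)]
    refine measureReal_mono (fun ω hω => ⟨hω.1, ?_⟩)
    simp only [mem_setOf_eq, hubCount]
    have : 0 < ((A ∩ S p).filter fun a' => inS (S p) (cyc p) ω ∈ openConn (cyc p) a').card :=
      Finset.card_pos.2 ⟨a, Finset.mem_filter.2 ⟨ha, hω.2⟩⟩
    omega
  · -- the anchor is a relay
    have haZ : cyc p ∈ A ∩ Z := Finset.mem_inter.2 ⟨hcp, H.cycZ p hp.1 hp.2⟩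
    refine (hq (cyc p) haZ).trans ?_
    rw [real_onReach_cyc_eq H hw hp.2]
    have h1 : (prodBernoulli w).real {ω | 1 ≤ hubCount cyc S A p ω} = 1 := by
      have : {ω : BondConfig (Fin n) | 1 ≤ hubCount cyc S A p ω} = Set.univ := by
        ext ω; simp only [mem_setOf_eq, Set.mem_univ, iff_true, hubCount, if_pos hcp]; omega
      rw [this, probReal_univ]
    rw [h1, mul_one]

/-! ## The transfer theorem -/

/-- **THE k-HUB TRANSFER THEOREM.**  For a pendant cycle block with hubs (`Block.IsCycleBlock`, weights `Block.CycleHang`), an observer `o ∉ Z`,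
at least one block relay, and the hub-decoupled weights `w' = Block.cdecouple …`: `P_{w'}(#{a ∈ A : o ↔ a} ≤ 1) ≤ t` and `P_w(o ↮ a) ≤ t` on
the block relays imply `P_w(#{a ∈ A : o ↔ a} ≤ 1) ≤ t`. [this work] -/
theorem real_card_le_one_le_cycleBlock {o : Fin n} (ho : o ∉ Z) (hAZ : (A ∩ Z).Nonempty) (t : ℝ)
    (hcut : ∀ a ∈ A ∩ Z, (prodBernoulli w).real (openConn o a)ᶜ ≤ t)
    (hfar' : (prodBernoulli (cdecouple L cyc S Z w)).real {ω : BondConfig (Fin n) | (A.filter fun a => ω ∈ openConn o a).card ≤ 1} ≤ t) :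
    (prodBernoulli w).real {ω : BondConfig (Fin n) | (A.filter fun a => ω ∈ openConn o a).card ≤ 1} ≤ t := by
  set ps := loadedList L cyc S A with hpsdef
  set C := chainOf L cyc S A w 0 ps with hC
  have hV : C.Valid ps.length :=
    chainOf_valid w A (loadedList_sorted L cyc S A) (fun p _ => Nat.zero_le p) (fun p hp => (loadedList_bound L cyc S A p hp).2.le) (Nat.zero_le L)
  -- the exit point: the least internal tip marginal
  set τ : Fin n → ℝ := fun a => (prodBernoulli w).real {ω | onZ Z ω ∈ openConn (cyc 0) a} with hτ
  obtain ⟨a₀, ha₀, hmin⟩ := (A ∩ Z).exists_min_image τ hAZ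
  set q := τ a₀ with hq
  have hq0 : 0 ≤ q := measureReal_nonneg
  have hq1 : q ≤ 1 := measureReal_le_one
  obtain ⟨lam, hlam0, hlam1, hdomh, hdomt⟩ := TwoChain.cycDec ps.length C hV q hq0 (tip_le_mu H w hw A q hmin)
  refine real_card_le_one_le_of_dominates w (cdecouple L cyc S Z w) ho H.cZ hw.hangZ (cdecouple_hangZ H w)
    (fun e he => (cdecouple_of_avoid w he).symm) A t q lam hlam0 hlam1 hq1 ha₀ le_rfl (hcut a₀ ha₀) ?_ ?_ hfar'
  · rw [real_blockCount_cd_ge_one H w hw A, real_blockCount_ge_one H w hw A]; exact hdomh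
  · rw [real_blockCount_cd_ge_two H w hw A, real_blockCount_ge_two H w hw A]; exact hdomt

/-! ## Marginals are preserved; the layer-one FAR instance transfers -/

omit hw in
/-- Internal marginal of the anchor under the decoupled weights: `P_{w'}(c ↔ cyc j on Z) = P_{w'}(stem j open)`. [this work] -/
theorem real_onReach_cyc_cd {j : ℕ} (hj : 1 ≤ j ∧ j < L) :
    (prodBernoulli (cdecouple L cyc S Z w)).real {ω | onZ Z ω ∈ openConn (cyc 0) (cyc j)} =
      (prodBernoulli (cdecouple L cyc S Z w)).real {ω | s(cyc 0, cyc j) ∈ ω} :=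
  real_congr_cd H w _ _ fun ω hω => by
    simp only [mem_setOf_eq]
    have hgood : ∀ i ∈ cpos L, Good (cyc i) (S i) ω := fun i hi => hω.2.1 i (mem_cpos.1 hi).1 (mem_cpos.1 hi).2
    rw [show (onZ Z ω ∈ openConn (cyc 0) (cyc j)) = (openGraph (onZ Z ω)).Reachable (cyc 0) (cyc j) from rfl,
      on_reach_iff_core_family (isHubFamily H) hgood (fun i hi => H.cycS j i hj.2 (mem_cpos.1 hi).1 (mem_cpos.1 hi).2)]
    exact coreReach_iff_stem H hω hj

omit hw in
/-- Internal marginal of a hub vertex under the decoupled weights. [this work] -/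
theorem real_onReach_hub_cd {j : ℕ} (hj : 1 ≤ j ∧ j < L) {a : Fin n} (ha : a ∈ S j) :
    (prodBernoulli (cdecouple L cyc S Z w)).real {ω | onZ Z ω ∈ openConn (cyc 0) a} =
      (prodBernoulli (cdecouple L cyc S Z w)).real ({ω | s(cyc 0, cyc j) ∈ ω} ∩ {ω | inS (S j) (cyc j) ω ∈ openConn (cyc j) a}) :=
  real_congr_cd H w _ _ fun ω hω => by
    simp only [mem_setOf_eq, Set.mem_inter_iff]
    have hgood : ∀ i ∈ cpos L, Good (cyc i) (S i) ω := fun i hi => hω.2.1 i (mem_cpos.1 hi).1 (mem_cpos.1 hi).2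
    rw [show (onZ Z ω ∈ openConn (cyc 0) a) = (openGraph (onZ Z ω)).Reachable (cyc 0) a from rfl,
      on_reach_hub_iff_family (isHubFamily H) hgood (mem_cpos.2 hj) ha]
    exact and_congr (coreReach_iff_stem H hω hj) Iff.rfl

/-- **Hub-decoupling preserves the marginals**: `P_{w'}(o ↔ a) = P_w(o ↔ a)` for every vertex `a` (`o ∉ Z`). [this work] -/
theorem real_openConn_cdecouple_eq {o : Fin n} (ho : o ∉ Z) (a : Fin n) :
    (prodBernoulli (cdecouple L cyc S Z w)).real (openConn o a) = (prodBernoulli w).real (openConn o a) := by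
  have hmeas : ∀ U : Set (BondConfig (Fin n)), MeasurableSet U := fun U => (Set.toFinite U).measurableSet
  set w' := cdecouple L cyc S Z w with hw'
  have hagree : ∀ e ∈ avoid Z, w e = w' e := fun e he => (cdecouple_of_avoid w he).symm
  by_cases haZ : a ∈ Z
  · rw [real_openConn_in_eq w' ho H.cZ (cdecouple_hangZ H w) haZ, real_openConn_in_eq w ho H.cZ hw.hangZ haZ,
      ← real_offZ_event_eq_of_agree w w' Z hagree (fun η => η ∈ openConn o (cyc 0))]
    congr 1
    obtain ⟨j, hj1, hjL, hja⟩ := H.Zsub a haZ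
    rcases hja with rfl | haS
    · rw [real_onReach_cyc_cd H w ⟨hj1, hjL⟩, real_stem_open H w hw ⟨hj1, hjL⟩, real_onReach_cyc_eq H hw hjL, real_RC w H hjL.le]
    · rw [real_onReach_hub_cd H w ⟨hj1, hjL⟩ haS, real_onReach_hub_eq H hw hj1 hjL haS, real_RC_inter_inS H w ⟨hj1, hjL⟩,
        real_RC w H hjL.le]
      have dS : DeterminedBy {ω : BondConfig (Fin n) | s(cyc 0, cyc j) ∈ ω} (↑({s(cyc 0, cyc j)} : Finset (Sym2 (Fin n))) : Set (Sym2 (Fin n))) :=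
        (readsOff_mem s(cyc 0, cyc j)).determinedBy id
      have hd : Disjoint ({s(cyc 0, cyc j)} : Finset (Sym2 (Fin n))) (hubPairs (S j) (cyc j)) := by
        rw [Finset.disjoint_singleton_left]; exact stem_notMem_hubPairs H hjL ⟨hj1, hjL⟩
      rw [prodBernoulli_real_inter_of_determinedBy_disjoint w' hd dS (determinedBy_inS (S j) (cyc j) fun η => η ∈ openConn (cyc j) a)
        (hmeas _) (hmeas _), real_stem_open H w hw ⟨hj1, hjL⟩,
        prodBernoulli_real_eq_of_determinedBy w' w (fun e he => cdecouple_hub H w ⟨hj1, hjL⟩ (Finset.mem_coe.1 he))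
          (determinedBy_inS (S j) (cyc j) fun η => η ∈ openConn (cyc j) a) (hmeas _)]
  · rw [real_openConn_off_eq (c := cyc 0) w' ho (cdecouple_hangZ H w) haZ, real_openConn_off_eq (c := cyc 0) w ho hw.hangZ haZ,
      ← real_offZ_event_eq_of_agree w w' Z hagree (fun η => η ∈ openConn o a)]

/-- **The layer-one FAR instance transfers from the hub-decoupled weights.** [this work] -/
theorem farLayerOne_cycleBlock {o : Fin n} (ho : o ∉ Z) (hAZ : (A ∩ Z).Nonempty) (t : ℝ)
    (hfar' : (2 : ℝ) < ∑ a ∈ A, (prodBernoulli (cdecouple L cyc S Z w)).real (openConn o a) →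
      (∀ a ∈ A, (prodBernoulli (cdecouple L cyc S Z w)).real (openConn o a)ᶜ ≤ t) →
      (prodBernoulli (cdecouple L cyc S Z w)).real {ω : BondConfig (Fin n) | (A.filter fun a => ω ∈ openConn o a).card ≤ 1} ≤ t)
    (hsum : (2 : ℝ) < ∑ a ∈ A, (prodBernoulli w).real (openConn o a))
    (hcut : ∀ a ∈ A, (prodBernoulli w).real (openConn o a)ᶜ ≤ t) :
    (prodBernoulli w).real {ω : BondConfig (Fin n) | (A.filter fun a => ω ∈ openConn o a).card ≤ 1} ≤ t := by
  have hmeas : ∀ U : Set (BondConfig (Fin n)), MeasurableSet U := fun U => (Set.toFinite U).measurableSet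
  have hmarg : ∀ a ∈ A, (prodBernoulli (cdecouple L cyc S Z w)).real (openConn o a) = (prodBernoulli w).real (openConn o a) :=
    fun a _ => real_openConn_cdecouple_eq H w hw ho a
  have hsum' : (2 : ℝ) < ∑ a ∈ A, (prodBernoulli (cdecouple L cyc S Z w)).real (openConn o a) := by
    rw [Finset.sum_congr rfl hmarg]; exact hsum
  have hcut' : ∀ a ∈ A, (prodBernoulli (cdecouple L cyc S Z w)).real (openConn o a)ᶜ ≤ t := by
    intro a ha
    rw [probReal_compl_eq_one_sub (hmeas _), hmarg a ha, ← probReal_compl_eq_one_sub (hmeas _)]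
    exact hcut a ha
  exact real_card_le_one_le_cycleBlock H w hw A ho hAZ t (fun a ha => hcut a (Finset.mem_inter.1 ha).1) (hfar' hsum' hcut')

end CycleBlock

end Block

end Quant

end Summit.CriticalPhenomena.PercolationContinuityZ3.Theorems
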